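import Mathlib
import HarnessLib

/-!
# DBR column, rung B-P(P1): two-sided rational enclosures of `log p`, primes `p ≤ 67` (part A: 2 ≤ p ≤ 67)

RH-FREE elementary inequalities (LINE 1 of the label discipline): for each prime `p` in range a lemma
`log_<p>_bounds : lo < Real.log p ∧ Real.log p < hi` with 13-decimal rational `lo, hi` (widths `≤ 1e-12`),
each obtained from Mathlib's `Real.abs_log_sub_add_sum_range_le` (the logarithmic series with remainder)
applied to `log(p/N)` for a smooth neighbour `N` of `p`, plus the bounds already proved for the primes
dividing `N`. They feed the generic anti-persistence rung certificate (`DbrWallRungKit`): the prime terms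
`Λ(n)n^{-1/2}(log q' − log n)` of the two-point gap `2Ψ(s) − Ψ(2s)` at `s = (log q')/2` are bounded below
from these enclosures. Nothing here bears on the truth of RH. [folklore]
-/

set_option linter.dupNamespace false

noncomputable section

namespace Summit.RiemannHypothesis.RiemannHypothesis.Theorems.DbrWall.LogTable

/-- `0.6931471805599 < log 2 < 0.6931471805600` (`log 2 = −log(1 − 1/4) − log(1 − 1/3)`, 23 and 29 terms). [folklore] -/
theorem log_two_bounds : (0.6931471805599 : ℝ) < Real.log 2 ∧ Real.log 2 < 0.6931471805600 := by
  have hx1 : |(1 / 4 : ℝ)| < 1 := by rw [abs_of_pos (by norm_num)]; norm_num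
  have hx2 : |(1 / 3 : ℝ)| < 1 := by rw [abs_of_pos (by norm_num)]; norm_num
  have h1 := Real.abs_log_sub_add_sum_range_le hx1 23
  have h2 := Real.abs_log_sub_add_sum_range_le hx2 29
  have e1 : Real.log (1 - 1 / 4 : ℝ) = Real.log 3 - 2 * Real.log 2 := by
    rw [show (1 - 1 / 4 : ℝ) = 3 / 4 by norm_num, Real.log_div (by norm_num) (by norm_num),
      show (4 : ℝ) = 2 ^ 2 by norm_num, Real.log_pow]; push_cast; ring
  have e2 : Real.log (1 - 1 / 3 : ℝ) = Real.log 2 - Real.log 3 := by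
    rw [show (1 - 1 / 3 : ℝ) = 2 / 3 by norm_num, Real.log_div (by norm_num) (by norm_num)]
  rw [e1, abs_of_pos (by norm_num : (0:ℝ) < 1 / 4)] at h1
  rw [e2, abs_of_pos (by norm_num : (0:ℝ) < 1 / 3)] at h2
  obtain ⟨h1l, h1u⟩ := abs_le.1 h1
  obtain ⟨h2l, h2u⟩ := abs_le.1 h2
  simp only [Finset.sum_range_succ, Finset.sum_range_zero] at h1l h1u h2l h2u
  norm_num at h1l h1u h2l h2u
  constructor <;> linarith

/-- `1.0986122886680 < log 3 < 1.0986122886683` (from `log(3 / 4)` by 23 terms of the logarithmic series; width 3.0e-13). [folklore] -/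
theorem log_three_bounds : (1.0986122886680 : ℝ) < Real.log 3 ∧ Real.log 3 < 1.0986122886683 := by
  have hx : |(1 / 4 : ℝ)| < 1 := by rw [abs_of_pos (by norm_num)]; norm_num
  have h := Real.abs_log_sub_add_sum_range_le hx 23
  have hN : Real.log (4 : ℝ) = 2 * Real.log 2 := by
    rw [show (4 : ℝ) = 2 ^ 2 by norm_num]
    simp only [Real.log_pow]; push_cast; ring
  have e : Real.log (1 - 1 / 4 : ℝ) = Real.log 3 - (2 * Real.log 2) := by
    rw [show (1 - 1 / 4 : ℝ) = (3 : ℝ) / 4 by norm_num, Real.log_div (by norm_num) (by norm_num), hN]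
  rw [e, abs_of_pos (by norm_num : (0:ℝ) < 1 / 4)] at h
  obtain ⟨hl, hu⟩ := abs_le.1 h
  simp only [Finset.sum_range_succ, Finset.sum_range_zero] at hl hu
  norm_num at hl hu
  have hb2 := log_two_bounds
  constructor <;> linarith

/-- `1.6094379124340 < log 5 < 1.6094379124343` (from `log(4 / 5)` by 20 terms of the logarithmic series; width 3.0e-13). [folklore] -/
theorem log_five_bounds : (1.6094379124340 : ℝ) < Real.log 5 ∧ Real.log 5 < 1.6094379124343 := by
  have hx : |(1 / 5 : ℝ)| < 1 := by rw [abs_of_pos (by norm_num)]; norm_num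
  have h := Real.abs_log_sub_add_sum_range_le hx 20
  have hN : Real.log (4 : ℝ) = 2 * Real.log 2 := by
    rw [show (4 : ℝ) = 2 ^ 2 by norm_num]
    simp only [Real.log_pow]; push_cast; ring
  have e : Real.log (1 - 1 / 5 : ℝ) = (2 * Real.log 2) - Real.log 5 := by
    rw [show (1 - 1 / 5 : ℝ) = (4 : ℝ) / 5 by norm_num, Real.log_div (by norm_num) (by norm_num), hN]
  rw [e, abs_of_pos (by norm_num : (0:ℝ) < 1 / 5)] at h
  obtain ⟨hl, hu⟩ := abs_le.1 h
  simp only [Finset.sum_range_succ, Finset.sum_range_zero] at hl hu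
  norm_num at hl hu
  have hb2 := log_two_bounds
  constructor <;> linarith

/-- `1.9459101490551 < log 7 < 1.9459101490555` (from `log(7 / 8)` by 15 terms of the logarithmic series; width 4.0e-13). [folklore] -/
theorem log_seven_bounds : (1.9459101490551 : ℝ) < Real.log 7 ∧ Real.log 7 < 1.9459101490555 := by
  have hx : |(1 / 8 : ℝ)| < 1 := by rw [abs_of_pos (by norm_num)]; norm_num
  have h := Real.abs_log_sub_add_sum_range_le hx 15
  have hN : Real.log (8 : ℝ) = 3 * Real.log 2 := by
    rw [show (8 : ℝ) = 2 ^ 3 by norm_num]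
    simp only [Real.log_pow]; push_cast; ring
  have e : Real.log (1 - 1 / 8 : ℝ) = Real.log 7 - (3 * Real.log 2) := by
    rw [show (1 - 1 / 8 : ℝ) = (7 : ℝ) / 8 by norm_num, Real.log_div (by norm_num) (by norm_num), hN]
  rw [e, abs_of_pos (by norm_num : (0:ℝ) < 1 / 8)] at h
  obtain ⟨hl, hu⟩ := abs_le.1 h
  simp only [Finset.sum_range_succ, Finset.sum_range_zero] at hl hu
  norm_num at hl hu
  have hb2 := log_two_bounds
  constructor <;> linarith

/-- `2.3978952727982 < log 11 < 2.3978952727987` (from `log(10 / 11)` by 13 terms of the logarithmic series; width 5.0e-13). [folklore] -/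
theorem log_eleven_bounds : (2.3978952727982 : ℝ) < Real.log 11 ∧ Real.log 11 < 2.3978952727987 := by
  have hx : |(1 / 11 : ℝ)| < 1 := by rw [abs_of_pos (by norm_num)]; norm_num
  have h := Real.abs_log_sub_add_sum_range_le hx 13
  have hN : Real.log (10 : ℝ) = Real.log 2 + Real.log 5 := by
    rw [show (10 : ℝ) = 2 * 5 by norm_num]
    rw [Real.log_mul (by positivity) (by positivity)]
  have e : Real.log (1 - 1 / 11 : ℝ) = (Real.log 2 + Real.log 5) - Real.log 11 := by
    rw [show (1 - 1 / 11 : ℝ) = (10 : ℝ) / 11 by norm_num, Real.log_div (by norm_num) (by norm_num), hN]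
  rw [e, abs_of_pos (by norm_num : (0:ℝ) < 1 / 11)] at h
  obtain ⟨hl, hu⟩ := abs_le.1 h
  simp only [Finset.sum_range_succ, Finset.sum_range_zero] at hl hu
  norm_num at hl hu
  have hb2 := log_two_bounds
  have hb5 := log_five_bounds
  constructor <;> linarith

/-- `2.5649493574613 < log 13 < 2.5649493574619` (from `log(12 / 13)` by 12 terms of the logarithmic series; width 6.0e-13). [folklore] -/
theorem log_thirteen_bounds : (2.5649493574613 : ℝ) < Real.log 13 ∧ Real.log 13 < 2.5649493574619 := by
  have hx : |(1 / 13 : ℝ)| < 1 := by rw [abs_of_pos (by norm_num)]; norm_num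
  have h := Real.abs_log_sub_add_sum_range_le hx 12
  have hN : Real.log (12 : ℝ) = 2 * Real.log 2 + Real.log 3 := by
    rw [show (12 : ℝ) = 2 ^ 2 * 3 by norm_num]
    rw [Real.log_mul (by positivity) (by positivity)]
    simp only [Real.log_pow]; push_cast; ring
  have e : Real.log (1 - 1 / 13 : ℝ) = (2 * Real.log 2 + Real.log 3) - Real.log 13 := by
    rw [show (1 - 1 / 13 : ℝ) = (12 : ℝ) / 13 by norm_num, Real.log_div (by norm_num) (by norm_num), hN]
  rw [e, abs_of_pos (by norm_num : (0:ℝ) < 1 / 13)] at h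
  obtain ⟨hl, hu⟩ := abs_le.1 h
  simp only [Finset.sum_range_succ, Finset.sum_range_zero] at hl hu
  norm_num at hl hu
  have hb2 := log_two_bounds
  have hb3 := log_three_bounds
  constructor <;> linarith

/-- `2.8332133440560 < log 17 < 2.8332133440565` (from `log(16 / 17)` by 11 terms of the logarithmic series; width 5.0e-13). [folklore] -/
theorem log_seventeen_bounds : (2.8332133440560 : ℝ) < Real.log 17 ∧ Real.log 17 < 2.8332133440565 := by
  have hx : |(1 / 17 : ℝ)| < 1 := by rw [abs_of_pos (by norm_num)]; norm_num
  have h := Real.abs_log_sub_add_sum_range_le hx 11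
  have hN : Real.log (16 : ℝ) = 4 * Real.log 2 := by
    rw [show (16 : ℝ) = 2 ^ 4 by norm_num]
    simp only [Real.log_pow]; push_cast; ring
  have e : Real.log (1 - 1 / 17 : ℝ) = (4 * Real.log 2) - Real.log 17 := by
    rw [show (1 - 1 / 17 : ℝ) = (16 : ℝ) / 17 by norm_num, Real.log_div (by norm_num) (by norm_num), hN]
  rw [e, abs_of_pos (by norm_num : (0:ℝ) < 1 / 17)] at h
  obtain ⟨hl, hu⟩ := abs_le.1 h
  simp only [Finset.sum_range_succ, Finset.sum_range_zero] at hl hu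
  norm_num at hl hu
  have hb2 := log_two_bounds
  constructor <;> linarith

/-- `2.9444389791661 < log 19 < 2.9444389791669` (from `log(18 / 19)` by 10 terms of the logarithmic series; width 8.0e-13). [folklore] -/
theorem log_nineteen_bounds : (2.9444389791661 : ℝ) < Real.log 19 ∧ Real.log 19 < 2.9444389791669 := by
  have hx : |(1 / 19 : ℝ)| < 1 := by rw [abs_of_pos (by norm_num)]; norm_num
  have h := Real.abs_log_sub_add_sum_range_le hx 10
  have hN : Real.log (18 : ℝ) = Real.log 2 + 2 * Real.log 3 := by
    rw [show (18 : ℝ) = 2 * 3 ^ 2 by norm_num]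
    rw [Real.log_mul (by positivity) (by positivity)]
    simp only [Real.log_pow]; push_cast; ring
  have e : Real.log (1 - 1 / 19 : ℝ) = (Real.log 2 + 2 * Real.log 3) - Real.log 19 := by
    rw [show (1 - 1 / 19 : ℝ) = (18 : ℝ) / 19 by norm_num, Real.log_div (by norm_num) (by norm_num), hN]
  rw [e, abs_of_pos (by norm_num : (0:ℝ) < 1 / 19)] at h
  obtain ⟨hl, hu⟩ := abs_le.1 h
  simp only [Finset.sum_range_succ, Finset.sum_range_zero] at hl hu
  norm_num at hl hu
  have hb2 := log_two_bounds
  have hb3 := log_three_bounds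
  constructor <;> linarith

/-- `3.1354942159289 < log 23 < 3.1354942159296` (from `log(22 / 23)` by 10 terms of the logarithmic series; width 7.0e-13). [folklore] -/
theorem log_twentythree_bounds : (3.1354942159289 : ℝ) < Real.log 23 ∧ Real.log 23 < 3.1354942159296 := by
  have hx : |(1 / 23 : ℝ)| < 1 := by rw [abs_of_pos (by norm_num)]; norm_num
  have h := Real.abs_log_sub_add_sum_range_le hx 10
  have hN : Real.log (22 : ℝ) = Real.log 2 + Real.log 11 := by
    rw [show (22 : ℝ) = 2 * 11 by norm_num]
    rw [Real.log_mul (by positivity) (by positivity)]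
  have e : Real.log (1 - 1 / 23 : ℝ) = (Real.log 2 + Real.log 11) - Real.log 23 := by
    rw [show (1 - 1 / 23 : ℝ) = (22 : ℝ) / 23 by norm_num, Real.log_div (by norm_num) (by norm_num), hN]
  rw [e, abs_of_pos (by norm_num : (0:ℝ) < 1 / 23)] at h
  obtain ⟨hl, hu⟩ := abs_le.1 h
  simp only [Finset.sum_range_succ, Finset.sum_range_zero] at hl hu
  norm_num at hl hu
  have hb2 := log_two_bounds
  have hb11 := log_eleven_bounds
  constructor <;> linarith

/-- `3.3672958299861 < log 29 < 3.3672958299868` (from `log(28 / 29)` by 9 terms of the logarithmic series; width 7.0e-13). [folklore] -/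
theorem log_twentynine_bounds : (3.3672958299861 : ℝ) < Real.log 29 ∧ Real.log 29 < 3.3672958299868 := by
  have hx : |(1 / 29 : ℝ)| < 1 := by rw [abs_of_pos (by norm_num)]; norm_num
  have h := Real.abs_log_sub_add_sum_range_le hx 9
  have hN : Real.log (28 : ℝ) = 2 * Real.log 2 + Real.log 7 := by
    rw [show (28 : ℝ) = 2 ^ 2 * 7 by norm_num]
    rw [Real.log_mul (by positivity) (by positivity)]
    simp only [Real.log_pow]; push_cast; ring
  have e : Real.log (1 - 1 / 29 : ℝ) = (2 * Real.log 2 + Real.log 7) - Real.log 29 := by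
    rw [show (1 - 1 / 29 : ℝ) = (28 : ℝ) / 29 by norm_num, Real.log_div (by norm_num) (by norm_num), hN]
  rw [e, abs_of_pos (by norm_num : (0:ℝ) < 1 / 29)] at h
  obtain ⟨hl, hu⟩ := abs_le.1 h
  simp only [Finset.sum_range_succ, Finset.sum_range_zero] at hl hu
  norm_num at hl hu
  have hb2 := log_two_bounds
  have hb7 := log_seven_bounds
  constructor <;> linarith

/-- `3.4339872044849 < log 31 < 3.4339872044855` (from `log(31 / 32)` by 9 terms of the logarithmic series; width 6.0e-13). [folklore] -/
theorem log_thirtyone_bounds : (3.4339872044849 : ℝ) < Real.log 31 ∧ Real.log 31 < 3.4339872044855 := by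
  have hx : |(1 / 32 : ℝ)| < 1 := by rw [abs_of_pos (by norm_num)]; norm_num
  have h := Real.abs_log_sub_add_sum_range_le hx 9
  have hN : Real.log (32 : ℝ) = 5 * Real.log 2 := by
    rw [show (32 : ℝ) = 2 ^ 5 by norm_num]
    simp only [Real.log_pow]; push_cast; ring
  have e : Real.log (1 - 1 / 32 : ℝ) = Real.log 31 - (5 * Real.log 2) := by
    rw [show (1 - 1 / 32 : ℝ) = (31 : ℝ) / 32 by norm_num, Real.log_div (by norm_num) (by norm_num), hN]
  rw [e, abs_of_pos (by norm_num : (0:ℝ) < 1 / 32)] at h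
  obtain ⟨hl, hu⟩ := abs_le.1 h
  simp only [Finset.sum_range_succ, Finset.sum_range_zero] at hl hu
  norm_num at hl hu
  have hb2 := log_two_bounds
  constructor <;> linarith

/-- `3.6109179126439 < log 37 < 3.6109179126448` (from `log(36 / 37)` by 8 terms of the logarithmic series; width 9.0e-13). [folklore] -/
theorem log_thirtyseven_bounds : (3.6109179126439 : ℝ) < Real.log 37 ∧ Real.log 37 < 3.6109179126448 := by
  have hx : |(1 / 37 : ℝ)| < 1 := by rw [abs_of_pos (by norm_num)]; norm_num
  have h := Real.abs_log_sub_add_sum_range_le hx 8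
  have hN : Real.log (36 : ℝ) = 2 * Real.log 2 + 2 * Real.log 3 := by
    rw [show (36 : ℝ) = 2 ^ 2 * 3 ^ 2 by norm_num]
    rw [Real.log_mul (by positivity) (by positivity)]
    simp only [Real.log_pow]; push_cast; ring
  have e : Real.log (1 - 1 / 37 : ℝ) = (2 * Real.log 2 + 2 * Real.log 3) - Real.log 37 := by
    rw [show (1 - 1 / 37 : ℝ) = (36 : ℝ) / 37 by norm_num, Real.log_div (by norm_num) (by norm_num), hN]
  rw [e, abs_of_pos (by norm_num : (0:ℝ) < 1 / 37)] at h
  obtain ⟨hl, hu⟩ := abs_le.1 h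
  simp only [Finset.sum_range_succ, Finset.sum_range_zero] at hl hu
  norm_num at hl hu
  have hb2 := log_two_bounds
  have hb3 := log_three_bounds
  constructor <;> linarith

/-- `3.7135720667040 < log 41 < 3.7135720667047` (from `log(40 / 41)` by 8 terms of the logarithmic series; width 7.0e-13). [folklore] -/
theorem log_fortyone_bounds : (3.7135720667040 : ℝ) < Real.log 41 ∧ Real.log 41 < 3.7135720667047 := by
  have hx : |(1 / 41 : ℝ)| < 1 := by rw [abs_of_pos (by norm_num)]; norm_num
  have h := Real.abs_log_sub_add_sum_range_le hx 8
  have hN : Real.log (40 : ℝ) = 3 * Real.log 2 + Real.log 5 := by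
    rw [show (40 : ℝ) = 2 ^ 3 * 5 by norm_num]
    rw [Real.log_mul (by positivity) (by positivity)]
    simp only [Real.log_pow]; push_cast; ring
  have e : Real.log (1 - 1 / 41 : ℝ) = (3 * Real.log 2 + Real.log 5) - Real.log 41 := by
    rw [show (1 - 1 / 41 : ℝ) = (40 : ℝ) / 41 by norm_num, Real.log_div (by norm_num) (by norm_num), hN]
  rw [e, abs_of_pos (by norm_num : (0:ℝ) < 1 / 41)] at h
  obtain ⟨hl, hu⟩ := abs_le.1 h
  simp only [Finset.sum_range_succ, Finset.sum_range_zero] at hl hu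
  norm_num at hl hu
  have hb2 := log_two_bounds
  have hb5 := log_five_bounds
  constructor <;> linarith

/-- `3.7612001156932 < log 43 < 3.7612001156941` (from `log(43 / 44)` by 8 terms of the logarithmic series; width 9.0e-13). [folklore] -/
theorem log_fortythree_bounds : (3.7612001156932 : ℝ) < Real.log 43 ∧ Real.log 43 < 3.7612001156941 := by
  have hx : |(1 / 44 : ℝ)| < 1 := by rw [abs_of_pos (by norm_num)]; norm_num
  have h := Real.abs_log_sub_add_sum_range_le hx 8
  have hN : Real.log (44 : ℝ) = 2 * Real.log 2 + Real.log 11 := by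
    rw [show (44 : ℝ) = 2 ^ 2 * 11 by norm_num]
    rw [Real.log_mul (by positivity) (by positivity)]
    simp only [Real.log_pow]; push_cast; ring
  have e : Real.log (1 - 1 / 44 : ℝ) = Real.log 43 - (2 * Real.log 2 + Real.log 11) := by
    rw [show (1 - 1 / 44 : ℝ) = (43 : ℝ) / 44 by norm_num, Real.log_div (by norm_num) (by norm_num), hN]
  rw [e, abs_of_pos (by norm_num : (0:ℝ) < 1 / 44)] at h
  obtain ⟨hl, hu⟩ := abs_le.1 h
  simp only [Finset.sum_range_succ, Finset.sum_range_zero] at hl hu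
  norm_num at hl hu
  have hb2 := log_two_bounds
  have hb11 := log_eleven_bounds
  constructor <;> linarith

/-- `3.8501476017097 < log 47 < 3.8501476017106` (from `log(46 / 47)` by 8 terms of the logarithmic series; width 9.0e-13). [folklore] -/
theorem log_fortyseven_bounds : (3.8501476017097 : ℝ) < Real.log 47 ∧ Real.log 47 < 3.8501476017106 := by
  have hx : |(1 / 47 : ℝ)| < 1 := by rw [abs_of_pos (by norm_num)]; norm_num
  have h := Real.abs_log_sub_add_sum_range_le hx 8
  have hN : Real.log (46 : ℝ) = Real.log 2 + Real.log 23 := by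
    rw [show (46 : ℝ) = 2 * 23 by norm_num]
    rw [Real.log_mul (by positivity) (by positivity)]
  have e : Real.log (1 - 1 / 47 : ℝ) = (Real.log 2 + Real.log 23) - Real.log 47 := by
    rw [show (1 - 1 / 47 : ℝ) = (46 : ℝ) / 47 by norm_num, Real.log_div (by norm_num) (by norm_num), hN]
  rw [e, abs_of_pos (by norm_num : (0:ℝ) < 1 / 47)] at h
  obtain ⟨hl, hu⟩ := abs_le.1 h
  simp only [Finset.sum_range_succ, Finset.sum_range_zero] at hl hu
  norm_num at hl hu
  have hb2 := log_two_bounds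
  have hb23 := log_twentythree_bounds
  constructor <;> linarith

/-- `3.9702919135517 < log 53 < 3.9702919135526` (from `log(52 / 53)` by 8 terms of the logarithmic series; width 9.0e-13). [folklore] -/
theorem log_fiftythree_bounds : (3.9702919135517 : ℝ) < Real.log 53 ∧ Real.log 53 < 3.9702919135526 := by
  have hx : |(1 / 53 : ℝ)| < 1 := by rw [abs_of_pos (by norm_num)]; norm_num
  have h := Real.abs_log_sub_add_sum_range_le hx 8
  have hN : Real.log (52 : ℝ) = 2 * Real.log 2 + Real.log 13 := by
    rw [show (52 : ℝ) = 2 ^ 2 * 13 by norm_num]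
    rw [Real.log_mul (by positivity) (by positivity)]
    simp only [Real.log_pow]; push_cast; ring
  have e : Real.log (1 - 1 / 53 : ℝ) = (2 * Real.log 2 + Real.log 13) - Real.log 53 := by
    rw [show (1 - 1 / 53 : ℝ) = (52 : ℝ) / 53 by norm_num, Real.log_div (by norm_num) (by norm_num), hN]
  rw [e, abs_of_pos (by norm_num : (0:ℝ) < 1 / 53)] at h
  obtain ⟨hl, hu⟩ := abs_le.1 h
  simp only [Finset.sum_range_succ, Finset.sum_range_zero] at hl hu
  norm_num at hl hu
  have hb2 := log_two_bounds
  have hb13 := log_thirteen_bounds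
  constructor <;> linarith

/-- `4.0775374439052 < log 59 < 4.0775374439062` (from `log(58 / 59)` by 7 terms of the logarithmic series; width 1.0e-12). [folklore] -/
theorem log_fiftynine_bounds : (4.0775374439052 : ℝ) < Real.log 59 ∧ Real.log 59 < 4.0775374439062 := by
  have hx : |(1 / 59 : ℝ)| < 1 := by rw [abs_of_pos (by norm_num)]; norm_num
  have h := Real.abs_log_sub_add_sum_range_le hx 7
  have hN : Real.log (58 : ℝ) = Real.log 2 + Real.log 29 := by
    rw [show (58 : ℝ) = 2 * 29 by norm_num]
    rw [Real.log_mul (by positivity) (by positivity)]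
  have e : Real.log (1 - 1 / 59 : ℝ) = (Real.log 2 + Real.log 29) - Real.log 59 := by
    rw [show (1 - 1 / 59 : ℝ) = (58 : ℝ) / 59 by norm_num, Real.log_div (by norm_num) (by norm_num), hN]
  rw [e, abs_of_pos (by norm_num : (0:ℝ) < 1 / 59)] at h
  obtain ⟨hl, hu⟩ := abs_le.1 h
  simp only [Finset.sum_range_succ, Finset.sum_range_zero] at hl hu
  norm_num at hl hu
  have hb2 := log_two_bounds
  have hb29 := log_twentynine_bounds
  constructor <;> linarith

/-- `4.1108738641730 < log 61 < 4.1108738641738` (from `log(61 / 62)` by 7 terms of the logarithmic series; width 8.0e-13). [folklore] -/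
theorem log_sixtyone_bounds : (4.1108738641730 : ℝ) < Real.log 61 ∧ Real.log 61 < 4.1108738641738 := by
  have hx : |(1 / 62 : ℝ)| < 1 := by rw [abs_of_pos (by norm_num)]; norm_num
  have h := Real.abs_log_sub_add_sum_range_le hx 7
  have hN : Real.log (62 : ℝ) = Real.log 2 + Real.log 31 := by
    rw [show (62 : ℝ) = 2 * 31 by norm_num]
    rw [Real.log_mul (by positivity) (by positivity)]
  have e : Real.log (1 - 1 / 62 : ℝ) = Real.log 61 - (Real.log 2 + Real.log 31) := by
    rw [show (1 - 1 / 62 : ℝ) = (61 : ℝ) / 62 by norm_num, Real.log_div (by norm_num) (by norm_num), hN]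
  rw [e, abs_of_pos (by norm_num : (0:ℝ) < 1 / 62)] at h
  obtain ⟨hl, hu⟩ := abs_le.1 h
  simp only [Finset.sum_range_succ, Finset.sum_range_zero] at hl hu
  norm_num at hl hu
  have hb2 := log_two_bounds
  have hb31 := log_thirtyone_bounds
  constructor <;> linarith

/-- `4.2046926193906 < log 67 < 4.2046926193914` (from `log(67 / 68)` by 7 terms of the logarithmic series; width 8.0e-13). [folklore] -/
theorem log_sixtyseven_bounds : (4.2046926193906 : ℝ) < Real.log 67 ∧ Real.log 67 < 4.2046926193914 := by
  have hx : |(1 / 68 : ℝ)| < 1 := by rw [abs_of_pos (by norm_num)]; norm_num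
  have h := Real.abs_log_sub_add_sum_range_le hx 7
  have hN : Real.log (68 : ℝ) = 2 * Real.log 2 + Real.log 17 := by
    rw [show (68 : ℝ) = 2 ^ 2 * 17 by norm_num]
    rw [Real.log_mul (by positivity) (by positivity)]
    simp only [Real.log_pow]; push_cast; ring
  have e : Real.log (1 - 1 / 68 : ℝ) = Real.log 67 - (2 * Real.log 2 + Real.log 17) := by
    rw [show (1 - 1 / 68 : ℝ) = (67 : ℝ) / 68 by norm_num, Real.log_div (by norm_num) (by norm_num), hN]
  rw [e, abs_of_pos (by norm_num : (0:ℝ) < 1 / 68)] at h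
  obtain ⟨hl, hu⟩ := abs_le.1 h
  simp only [Finset.sum_range_succ, Finset.sum_range_zero] at hl hu
  norm_num at hl hu
  have hb2 := log_two_bounds
  have hb17 := log_seventeen_bounds
  constructor <;> linarith

end Summit.RiemannHypothesis.RiemannHypothesis.Theorems.DbrWall.LogTable
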